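import Summits.QuantumAdvantage.QuantumAdvantage.Theorems.SymplecticPurityDlogGraphFlatBandA
import Summits.QuantumAdvantage.QuantumAdvantage.Theorems.SymplecticPurityDlogGraphFlatFlank

/-!
# Crux `DlogGraphFlat` (stmt-QuantumAdvantage-10732), line `Sketch` — band differentials, part B

`stub_dlogBandReduction`: the spread-set multiplicative-energy bound (R4, registered as
`stub_dlogSpreadEnergy`: `E×(c + S_b) ≤ C·2^{(3−κ)|b|}` uniformly in translates `c`, for masks
with `2|b| ≤ n`) implies the band differential bound `stub_dlogDiffBand` of the crux skeleton:
`D(a,a') ≤ 2^{(1−δ)n}` eventually, in the band `m(a)+m(a')+3 ≥ n − ⌊n/16⌋`, with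
`δ = min(7κ/128, 1/32)`. Ingredients: part A (`stub_dlogBandCount`, `band_triple_pow_four_le`),
the NAF-guard price of the exceptional classes (`dlogDiff_exceptional_le`, flank part B), the
normal forms of the differential equation (direct for `|a'| ≤ n/2`, complemented otherwise), and
real-exponent bookkeeping (`band_N_le`, `exc_numerics`).
-/

set_option linter.dupNamespace false -- D-0017: single-problem summit ⇒ `QuantumAdvantage.QuantumAdvantage` by design

namespace Summit.QuantumAdvantage.QuantumAdvantage.Theorems.SymplecticPurity

open Finset Literature.Combinatorics.Additive

/-! ### Assembly: the band from the spread-set energy -/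

section BandAssembly

open Literature.Computability.QuantumComplexity Literature.Computability.Cryptography
open Literature.Computability.AlgebraicComplexity.BoolGadgets (ofBits_eq_sum ofBits_injective)

variable {n : ℕ}

/-- `ofBits (¬y) + ofBits y = 2ⁿ − 1`. -/
theorem ofBits_not_add (y : QReg n) : Nat.ofBits (fun j => !y j) + Nat.ofBits y = 2 ^ n - 1 := by
  rw [ofBits_eq_sum, ofBits_eq_sum, ← Finset.sum_add_distrib]
  have h : ∀ t : Fin n, (!y t).toNat * 2 ^ (t : ℕ) + (y t).toNat * 2 ^ (t : ℕ) = 2 ^ (t : ℕ) := by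
    intro t; cases y t <;> simp
  rw [Finset.sum_congr rfl (fun t _ => h t), Fin.sum_univ_eq_sum_range (fun i => 2 ^ i) n,
    Nat.geomSum_eq (le_refl 2) n]
  simp

/-- `ofBits (y ⊕ b) + 2·ofBits (y ∧ b) = ofBits b + ofBits y`. -/
theorem ofBits_flip_add_two_mul (y b : QReg n) :
    Nat.ofBits (fun j => Bool.xor (y j) (b j)) + 2 * Nat.ofBits (fun j => y j && b j) =
      Nat.ofBits b + Nat.ofBits y := by
  have h1 := ofBits_flip_add y b
  have h2 := ofBits_split y b
  omega

/-- The numerical heart of the band bound: from the two triple-count bounds, the spread-set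
energy bound and the position of `(|a|, |b|)` in the band, `N ≤ K · 2^{(1 − 7κ/64) n}`
with `K = (32C)^{1/4} 2^κ`. -/
theorem band_N_le (κ C : ℝ) (hκ : 0 < κ) (hC : 0 < C) (n k kb N E : ℕ) (hk : k ≤ n)
    (hkb2 : 2 * kb ≤ n) (hkb7 : 7 * n ≤ 16 * kb + 64)
    (hN1 : N ^ 4 ≤ (4 * 2 ^ k) ^ 2 * (E * (2 * (2 ^ (n - k)) ^ 3)))
    (hN2 : N ^ 4 ≤ (2 * 2 ^ (n - k)) ^ 2 * (E * (4 * (2 ^ k) ^ 3)))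
    (hE : (E : ℝ) ≤ C * (2 : ℝ) ^ ((3 - κ) * (kb : ℝ))) :
    (N : ℝ) ≤ ((32 * C) ^ (4 : ℝ)⁻¹ * (2 : ℝ) ^ κ) * (2 : ℝ) ^ ((1 - 7 * κ / 64) * (n : ℝ)) := by
  have h2pos : (0 : ℝ) < 2 := by norm_num
  have hpow : ∀ m : ℕ, ((2 ^ m : ℕ) : ℝ) = (2 : ℝ) ^ ((m : ℕ) : ℝ) := by
    intro m; rw [Real.rpow_natCast]; push_cast; ring
  have hkR : ((n - k : ℕ) : ℝ) = (n : ℝ) - k := Nat.cast_sub hk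
  have hE0 : (0 : ℝ) ≤ E := Nat.cast_nonneg _
  -- Step 1: in both orderings, (N:ℝ)^4 ≤ 32 C · 2^{4n − κ kb}
  have hcomb : ∀ (x y : ℝ), ((2 : ℝ) ^ x) ^ 2 * ((2 : ℝ) ^ y) ^ 3 = (2 : ℝ) ^ (2 * x + 3 * y) := by
    intro x y
    rw [← Real.rpow_natCast ((2 : ℝ) ^ x) 2, ← Real.rpow_natCast ((2 : ℝ) ^ y) 3,
      ← Real.rpow_mul h2pos.le, ← Real.rpow_mul h2pos.le, ← Real.rpow_add h2pos]
    norm_num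
    ring_nf
  have P1 : (2 : ℝ) ^ (n - k) = (2 : ℝ) ^ ((n : ℝ) - k) := by rw [← hkR, Real.rpow_natCast]
  have P2 : (2 : ℝ) ^ k = (2 : ℝ) ^ ((k : ℝ)) := by rw [Real.rpow_natCast]
  have cN1 : ((N : ℝ)) ^ 4 ≤ (4 * (2 : ℝ) ^ k) ^ 2 * ((E : ℝ) * (2 * ((2 : ℝ) ^ (n - k)) ^ 3)) := by
    exact_mod_cast hN1
  have cN2 : ((N : ℝ)) ^ 4 ≤ (2 * (2 : ℝ) ^ (n - k)) ^ 2 * ((E : ℝ) * (4 * ((2 : ℝ) ^ k) ^ 3)) := by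
    exact_mod_cast hN2
  rw [P1, P2] at cN1 cN2
  have hb : (2 : ℝ) * kb ≤ n := by exact_mod_cast hkb2
  have hEC : (0 : ℝ) ≤ C * (2 : ℝ) ^ ((3 - κ) * (kb : ℝ)) := by positivity
  have key : ((N : ℝ)) ^ 4 ≤ 32 * C * (2 : ℝ) ^ (4 * (n : ℝ) - κ * kb) := by
    by_cases hcase : 2 * k ≤ n
    · -- ordering 2: exponent 2(n-k) + 3k + (3-κ)kb ≤ 4n - κ kb
      have hc : (2 : ℝ) * k ≤ n := by exact_mod_cast hcase
      have hexp : (2 * ((n : ℝ) - k) + 3 * k) + (3 - κ) * kb ≤ 4 * (n : ℝ) - κ * kb := by nlinarith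
      calc ((N : ℝ)) ^ 4 ≤ (2 * (2 : ℝ) ^ ((n : ℝ) - k)) ^ 2 * ((E : ℝ) * (4 * ((2 : ℝ) ^ (k : ℝ)) ^ 3)) := cN2
        _ = 16 * E * (((2 : ℝ) ^ ((n : ℝ) - k)) ^ 2 * ((2 : ℝ) ^ (k : ℝ)) ^ 3) := by ring
        _ = 16 * E * (2 : ℝ) ^ (2 * ((n : ℝ) - k) + 3 * k) := by rw [hcomb]
        _ ≤ 16 * (C * (2 : ℝ) ^ ((3 - κ) * (kb : ℝ))) * (2 : ℝ) ^ (2 * ((n : ℝ) - k) + 3 * k) :=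
            mul_le_mul_of_nonneg_right (mul_le_mul_of_nonneg_left hE (by norm_num)) (by positivity)
        _ = 16 * C * (2 : ℝ) ^ ((2 * ((n : ℝ) - k) + 3 * k) + (3 - κ) * kb) := by
            rw [Real.rpow_add h2pos (2 * ((n : ℝ) - k) + 3 * k) ((3 - κ) * kb)]; ring
        _ ≤ 16 * C * (2 : ℝ) ^ (4 * (n : ℝ) - κ * kb) :=
            mul_le_mul_of_nonneg_left (Real.rpow_le_rpow_of_exponent_le (by norm_num) hexp)
              (by positivity)
        _ ≤ 32 * C * (2 : ℝ) ^ (4 * (n : ℝ) - κ * kb) := by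
            have : (0 : ℝ) ≤ C * (2 : ℝ) ^ (4 * (n : ℝ) - κ * kb) := by positivity
            nlinarith
    · -- ordering 1: exponent 2k + 3(n-k) + (3-κ)kb ≤ 4n - κ kb
      push Not at hcase
      have hc : (n : ℝ) < 2 * k := by exact_mod_cast hcase
      have hexp : (2 * (k : ℝ) + 3 * ((n : ℝ) - k)) + (3 - κ) * kb ≤ 4 * (n : ℝ) - κ * kb := by
        nlinarith
      calc ((N : ℝ)) ^ 4 ≤ (4 * (2 : ℝ) ^ (k : ℝ)) ^ 2 * ((E : ℝ) * (2 * ((2 : ℝ) ^ ((n : ℝ) - k)) ^ 3)) := cN1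
        _ = 32 * E * (((2 : ℝ) ^ (k : ℝ)) ^ 2 * ((2 : ℝ) ^ ((n : ℝ) - k)) ^ 3) := by ring
        _ = 32 * E * (2 : ℝ) ^ (2 * (k : ℝ) + 3 * ((n : ℝ) - k)) := by rw [hcomb]
        _ ≤ 32 * (C * (2 : ℝ) ^ ((3 - κ) * (kb : ℝ))) * (2 : ℝ) ^ (2 * (k : ℝ) + 3 * ((n : ℝ) - k)) :=
            mul_le_mul_of_nonneg_right (mul_le_mul_of_nonneg_left hE (by norm_num)) (by positivity)
        _ = 32 * C * (2 : ℝ) ^ ((2 * (k : ℝ) + 3 * ((n : ℝ) - k)) + (3 - κ) * kb) := by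
            rw [Real.rpow_add h2pos (2 * (k : ℝ) + 3 * ((n : ℝ) - k)) ((3 - κ) * kb)]; ring
        _ ≤ 32 * C * (2 : ℝ) ^ (4 * (n : ℝ) - κ * kb) :=
            mul_le_mul_of_nonneg_left (Real.rpow_le_rpow_of_exponent_le (by norm_num) hexp)
              (by positivity)
  -- Step 2: use kb ≥ 7n/16 - 4
  have key2 : ((N : ℝ)) ^ 4 ≤
      (((32 * C) ^ (4 : ℝ)⁻¹ * (2 : ℝ) ^ κ) * (2 : ℝ) ^ ((1 - 7 * κ / 64) * (n : ℝ))) ^ 4 := by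
    have hkb : (7 : ℝ) * n ≤ 16 * kb + 64 := by exact_mod_cast hkb7
    have hexp : 4 * (n : ℝ) - κ * kb ≤ 4 * κ + 4 * ((1 - 7 * κ / 64) * (n : ℝ)) := by nlinarith
    have h32 : (0 : ℝ) ≤ 32 * C := by positivity
    calc ((N : ℝ)) ^ 4 ≤ 32 * C * (2 : ℝ) ^ (4 * (n : ℝ) - κ * kb) := key
      _ ≤ 32 * C * (2 : ℝ) ^ (4 * κ + 4 * ((1 - 7 * κ / 64) * (n : ℝ))) :=
          mul_le_mul_of_nonneg_left (Real.rpow_le_rpow_of_exponent_le (by norm_num) hexp) h32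
      _ = (((32 * C) ^ (4 : ℝ)⁻¹ * (2 : ℝ) ^ κ) * (2 : ℝ) ^ ((1 - 7 * κ / 64) * (n : ℝ))) ^ 4 := by
          rw [mul_pow, mul_pow, ← Real.rpow_natCast ((32 * C) ^ (4 : ℝ)⁻¹) 4,
            ← Real.rpow_mul h32, ← Real.rpow_natCast ((2 : ℝ) ^ κ) 4,
            ← Real.rpow_mul h2pos.le, ← Real.rpow_natCast ((2 : ℝ) ^ ((1 - 7 * κ / 64) * (n : ℝ))) 4,
            ← Real.rpow_mul h2pos.le, Real.rpow_add h2pos]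
          norm_num
          ring_nf
  have hN0 : (0 : ℝ) ≤ N := Nat.cast_nonneg _
  have hK0 : (0 : ℝ) ≤ ((32 * C) ^ (4 : ℝ)⁻¹ * (2 : ℝ) ^ κ) * (2 : ℝ) ^ ((1 - 7 * κ / 64) * (n : ℝ)) := by
    positivity
  exact (pow_le_pow_iff_left₀ hN0 hK0 (by norm_num : (4 : ℕ) ≠ 0)).mp key2

end BandAssembly

/-! ### The registered stubs: `stub_dlogSpreadEnergy → stub_dlogDiffBand` -/

section BandStub

open Literature.Computability.QuantumComplexity Literature.Computability.Cryptography
open Literature.Computability.AlgebraicComplexity.BoolGadgets (ofBits_eq_sum ofBits_injective)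

/-- Numerical bookkeeping: for `128 ≤ n` and `δ ≤ 1/32`, `2^{n − ⌊n/8⌋ + 2} ≤ ½ · 2^{(1−δ)n}`. -/
theorem exc_numerics (n : ℕ) (hn : 128 ≤ n) (δ : ℝ) (hδ : δ ≤ 1 / 32) :
    ((2 ^ (n - n / 8 + 2) : ℕ) : ℝ) ≤ (1 / 2) * (2 : ℝ) ^ ((1 - δ) * (n : ℝ)) := by
  have hle : n / 8 ≤ n := Nat.div_le_self _ _
  have h1 : ((2 ^ (n - n / 8 + 2) : ℕ) : ℝ) = (1 / 2) * (2 : ℝ) ^ (((n - n / 8 + 3 : ℕ) : ℕ) : ℝ) := by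
    rw [Real.rpow_natCast]; push_cast
    rw [show n - n / 8 + 3 = (n - n / 8 + 2) + 1 by omega, pow_succ]; ring
  rw [h1]
  refine mul_le_mul_of_nonneg_left (Real.rpow_le_rpow_of_exponent_le (by norm_num) ?_) (by norm_num)
  have hcast : ((n - n / 8 + 3 : ℕ) : ℝ) = (n : ℝ) - ((n / 8 : ℕ) : ℝ) + 3 := by
    rw [Nat.cast_add, Nat.cast_sub hle]; norm_num
  rw [hcast]
  have hdiv : (8 : ℕ) * (n / 8) + 8 > n := by omega
  have h8 : (8 : ℝ) * ((n / 8 : ℕ) : ℝ) + 8 > (n : ℝ) := by exact_mod_cast hdiv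
  have hn' : (128 : ℝ) ≤ n := by exact_mod_cast hn
  nlinarith

/-- **Stub `stub_dlogBandReduction`**: the spread-set multiplicative-energy bound (R4,
`stub_dlogSpreadEnergy`) implies the band differential bound (`stub_dlogDiffBand`) for the
DLOG S-box. Route: `D(a,a') ≤ N + #exceptional` (`band_card_le_triple_add_exceptional`, direct
form for `|a'| ≤ n/2`, complemented form `y ⊕ a' = ȳ ⊕ ā'` otherwise), `N⁴ ≤ 32 C 2^{4n − κ m(a')}`
(two Cauchy–Schwarz orderings, trivial energies of the multiplicative cubes, R4 for the spread
set), `m(a') ≥ 7n/16 − 3` in the band, and the NAF-guard price `2^{n−n/8+2}` of the exceptional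
classes; `δ = min(7κ/128, 1/32)`. -/
theorem stub_dlogBandReduction :
    (∃ κ : ℝ, 0 < κ ∧ ∃ C : ℝ, 0 < C ∧ ∀ (n p : ℕ), p.Prime → 2 ^ n ≤ 2 * p → ∀ b : QReg n,
      2 * (Finset.univ.filter fun j => b j = true).card ≤ n → ∀ c : ZMod p,
      (((((Finset.univ.image fun u : QReg n => fun j => u j && b j) ×ˢ
            (Finset.univ.image fun u : QReg n => fun j => u j && b j)) ×ˢ
          ((Finset.univ.image fun u : QReg n => fun j => u j && b j) ×ˢ
            (Finset.univ.image fun u : QReg n => fun j => u j && b j))).filter fun q =>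
          (c + ((Nat.ofBits b : ZMod p) - 2 * (Nat.ofBits q.1.1 : ZMod p))) *
            (c + ((Nat.ofBits b : ZMod p) - 2 * (Nat.ofBits q.2.2 : ZMod p))) =
          (c + ((Nat.ofBits b : ZMod p) - 2 * (Nat.ofBits q.1.2 : ZMod p))) *
            (c + ((Nat.ofBits b : ZMod p) - 2 * (Nat.ofBits q.2.1 : ZMod p)))).card : ℝ)
        ≤ C * (2 : ℝ) ^ ((3 - κ) * ((Finset.univ.filter fun j => b j = true).card : ℝ))) →
    (∃ δ : ℝ, 0 < δ ∧ ∃ n₀ : ℕ, ∀ n ≥ n₀, ∀ p g : ℕ, p.Prime → p < 2 ^ n →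
      2 ^ n ≤ p + 2 ^ (53 * n / 100) → orderOf (g : ZMod p) = p - 1 →
      (∀ c : Fin (n + 1) → ℤ, (∀ i, c i = 0 ∨ c i = 1 ∨ c i = -1) →
        ∑ i, c i * 2 ^ (i : ℕ) = (p : ℤ) - 1 → n ≤ 8 * (Finset.univ.filter fun i => c i ≠ 0).card) →
      ∀ a : QReg n, a ≠ (fun _ => false) → ∀ a' : QReg n,
      n - n / 16 ≤ min (Finset.univ.filter fun i => a i = true).card
            (n - (Finset.univ.filter fun i => a i = true).card) +
          min (Finset.univ.filter fun j => a' j = true).card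
            (n - (Finset.univ.filter fun j => a' j = true).card) + 3 →
      ((Finset.univ.filter fun x : QReg n =>
          (fun i : Fin n => Bool.xor ((g ^ Nat.ofBits (fun j => Bool.xor (x j) (a j)) % p).testBit (i : ℕ))
            ((g ^ Nat.ofBits x % p).testBit (i : ℕ))) = a').card : ℝ)
        ≤ (2 : ℝ) ^ ((1 - δ) * (n : ℝ))) := by
  rintro ⟨κ, hκ, C, hC, hR4⟩
  -- constants
  set δ : ℝ := min (7 * κ / 128) (1 / 32) with hδ
  have hδpos : 0 < δ := lt_min (by positivity) (by norm_num)
  have hδ1 : δ ≤ 7 * κ / 128 := min_le_left _ _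
  have hδ2 : δ ≤ 1 / 32 := min_le_right _ _
  set K : ℝ := (32 * C) ^ (4 : ℝ)⁻¹ * (2 : ℝ) ^ κ with hK
  have hKpos : 0 < K := by positivity
  obtain ⟨n₁, hn₁⟩ := exists_nat_ge (Real.logb 2 (2 * K) / (7 * κ / 128))
  refine ⟨δ, hδpos, max 128 n₁, ?_⟩
  intro n hn p g hp hpn hwin hg hguard a ha a' hband
  classical
  haveI := Fact.mk hp
  have hn128 : 128 ≤ n := le_trans (le_max_left _ _) hn
  have hnn₁ : n₁ ≤ n := le_trans (le_max_right _ _) hn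
  -- window numerics
  have h53 : 53 * n / 100 ≤ n - 2 := by omega
  have hq : 2 ^ (53 * n / 100) ≤ 2 ^ (n - 2) := Nat.pow_le_pow_right (by norm_num) h53
  have h2n : 2 ^ n = 4 * 2 ^ (n - 2) := by
    conv_lhs => rw [show n = (n - 2) + 2 from by omega, Nat.pow_add]
    ring
  have hq4 : 4 ≤ 2 ^ (n - 2) := by
    calc 4 = 2 ^ 2 := by norm_num
      _ ≤ 2 ^ (n - 2) := Nat.pow_le_pow_right (by norm_num) (by omega)
  have hp3 : 3 * 2 ^ (n - 2) ≤ p := by omega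
  have hp2 : 2 ≤ p := hp.two_le
  have h2p : 2 ^ n ≤ 2 * p := by omega
  have h2p1 : 2 ^ n ≤ 2 * (p - 1) := by omega
  have hn4 : 4 ≤ n := by omega
  -- notation
  set G : ZMod p := (g : ZMod p) with hG
  set f : QReg n → QReg n := fun x j => (g ^ Nat.ofBits x % p).testBit (j : ℕ) with hf
  have hf' : ∀ x j, f x j = (g ^ Nat.ofBits x % p).testBit (j : ℕ) := fun x j => rfl
  set S := (Finset.univ.filter fun x : QReg n =>
      (fun i : Fin n => Bool.xor ((g ^ Nat.ofBits (fun j => Bool.xor (x j) (a j)) % p).testBit (i : ℕ))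
        ((g ^ Nat.ofBits x % p).testBit (i : ℕ))) = a') with hS
  have hSmem : ∀ x ∈ S, f (fun j => Bool.xor (x j) (a j)) = fun j => Bool.xor (f x j) (a' j) := by
    intro x hx
    rw [hS, Finset.mem_filter] at hx
    funext i
    have := congrFun hx.2 i
    simp only [hf']
    rw [← this]
    cases (g ^ Nat.ofBits (fun j => (x j).xor (a j)) % p).testBit i <;>
      cases (g ^ Nat.ofBits x % p).testBit i <;> rfl
  set k' := (Finset.univ.filter fun j => a' j = true).card with hk'
  have hma : min (Finset.univ.filter fun i => a i = true).card
      (n - (Finset.univ.filter fun i => a i = true).card) ≤ n / 2 := by omega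
  -- the normal form, by cases on |a'| ≤ n/2
  obtain ⟨b, q, ε, c, hε, hb2, hb7, HYP⟩ : ∃ (b : QReg n) (q : QReg n → QReg n) (ε c : ZMod p),
      (ε = 1 ∨ ε = -1) ∧ 2 * (Finset.univ.filter fun j => b j = true).card ≤ n ∧
      7 * n ≤ 16 * (Finset.univ.filter fun j => b j = true).card + 64 ∧
      ∀ x ∈ S, G ^ Nat.ofBits (fun j => Bool.xor (x j) (a j)) - ε * G ^ Nat.ofBits x =
        c + ((Nat.ofBits b : ZMod p) - 2 * (Nat.ofBits (fun j => q x j && b j) : ZMod p)) := by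
    by_cases hcase : 2 * k' ≤ n
    · -- direct form: b = a', q = f, ε = 1, c = 0
      refine ⟨a', f, 1, 0, Or.inl rfl, hcase, ?_, ?_⟩
      · have : min k' (n - k') = k' := min_eq_left (by omega)
        rw [this] at hband
        omega
      · intro x hx
        have e1 := cast_ofBits_sbox hf' hp hpn (fun j => Bool.xor (x j) (a j))
        have e2 := cast_ofBits_sbox hf' hp hpn x
        rw [hSmem x hx] at e1
        have e3 := ofBits_flip_add_two_mul (f x) a'
        have e3' := congrArg (fun m : ℕ => (m : ZMod p)) e3
        push_cast at e3'
        rw [← hG] at e1 e2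
        rw [← e1, ← e2, one_mul]
        linear_combination e3'
    · -- complemented form: b = ¬a', q = ¬f, ε = −1, c = 2ⁿ − 1
      push Not at hcase
      set c₀ : ℕ := 2 ^ n - 1 with hc₀
      have hcardb : (Finset.univ.filter fun j => (!a' j) = true).card = n - k' := by
        rw [hk', ← card_filter_false_eq a']
        congr 1; ext j; simp
      refine ⟨fun j => !a' j, fun x j => !f x j, -1, (c₀ : ZMod p), Or.inr rfl, ?_, ?_, ?_⟩
      · rw [hcardb]; omega
      · rw [hcardb]
        have : min k' (n - k') = n - k' := min_eq_right (by omega)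
        rw [this] at hband
        omega
      · intro x hx
        have e1 := cast_ofBits_sbox hf' hp hpn (fun j => Bool.xor (x j) (a j))
        have e2 := cast_ofBits_sbox hf' hp hpn x
        rw [hSmem x hx] at e1
        have eflip : (fun j => Bool.xor (f x j) (a' j)) = fun j => Bool.xor (!f x j) (!a' j) := by
          funext j; cases f x j <;> cases a' j <;> rfl
        rw [eflip] at e1
        have e3 := ofBits_flip_add_two_mul (fun j => !f x j) (fun j => !a' j)
        have e4 := ofBits_not_add (f x)
        have e5 : Nat.ofBits (fun j => Bool.xor (!f x j) (!a' j)) +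
            2 * Nat.ofBits (fun j => (!f x j) && (!a' j)) + Nat.ofBits (f x) =
            Nat.ofBits (fun j => !a' j) + c₀ := by omega
        have e5' := congrArg (fun m : ℕ => (m : ZMod p)) e5
        push_cast at e5'
        rw [← hG] at e1 e2
        rw [← e1, ← e2]
        linear_combination e5'
  -- the triple count and its bounds
  have hD := band_card_le_triple_add_exceptional hp hg hp2 a b q ε c hε S HYP
  have hExc := dlogDiff_exceptional_le n p g hp hpn hwin hg hguard hn4 a ha
  obtain ⟨hN1, hN2⟩ := band_triple_pow_four_le hp hg h2p1 a b ε c hε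
    ((Finset.univ.image fun x : QReg n => fun j => x j && a j).filter fun w =>
      (g : ZMod p) ^ Nat.ofBits a * ((g : ZMod p) ^ Nat.ofBits w)⁻¹ - ε * (g : ZMod p) ^ Nat.ofBits w ≠ 0)
    (Finset.univ.image fun x : QReg n => fun j => x j && !a j)
    ((Finset.univ.image fun x : QReg n => fun j => x j && b j).filter fun u =>
      c + ((Nat.ofBits b : ZMod p) - 2 * (Nat.ofBits u : ZMod p)) ≠ 0)
    (Finset.univ.image fun x : QReg n => fun j => x j && b j)
    (Finset.filter_subset _ _) (subset_refl _) (Finset.filter_subset _ _)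
    (fun w hw => (Finset.mem_filter.1 hw).2) (fun u hu => (Finset.mem_filter.1 hu).2)
  have hE := hR4 n p hp h2p b hb2 c
  set N := ((((Finset.univ.image fun x : QReg n => fun j => x j && a j).filter fun w =>
      (g : ZMod p) ^ Nat.ofBits a * ((g : ZMod p) ^ Nat.ofBits w)⁻¹ - ε * (g : ZMod p) ^ Nat.ofBits w ≠ 0) ×ˢ
      ((Finset.univ.image fun x : QReg n => fun j => x j && !a j) ×ˢ
        ((Finset.univ.image fun x : QReg n => fun j => x j && b j).filter fun u =>
          c + ((Nat.ofBits b : ZMod p) - 2 * (Nat.ofBits u : ZMod p)) ≠ 0))).filter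
      fun t => (g : ZMod p) ^ Nat.ofBits t.2.1 *
        ((g : ZMod p) ^ Nat.ofBits a * ((g : ZMod p) ^ Nat.ofBits t.1)⁻¹ -
          ε * (g : ZMod p) ^ Nat.ofBits t.1) =
        c + ((Nat.ofBits b : ZMod p) - 2 * (Nat.ofBits t.2.2 : ZMod p))).card with hNdef
  set E := ((((Finset.univ.image fun u : QReg n => fun j => u j && b j) ×ˢ
        (Finset.univ.image fun u : QReg n => fun j => u j && b j)) ×ˢ
      ((Finset.univ.image fun u : QReg n => fun j => u j && b j) ×ˢ
        (Finset.univ.image fun u : QReg n => fun j => u j && b j))).filter fun q =>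
      (c + ((Nat.ofBits b : ZMod p) - 2 * (Nat.ofBits q.1.1 : ZMod p))) *
        (c + ((Nat.ofBits b : ZMod p) - 2 * (Nat.ofBits q.2.2 : ZMod p))) =
      (c + ((Nat.ofBits b : ZMod p) - 2 * (Nat.ofBits q.1.2 : ZMod p))) *
        (c + ((Nat.ofBits b : ZMod p) - 2 * (Nat.ofBits q.2.1 : ZMod p)))).card with hEdef
  set Exc := (Finset.univ.filter fun x : QReg n =>
      (g : ZMod p) ^ Nat.ofBits a = ((g : ZMod p) ^ Nat.ofBits (fun j => x j && a j)) ^ 2 ∨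
      (g : ZMod p) ^ Nat.ofBits a = -((g : ZMod p) ^ Nat.ofBits (fun j => x j && a j)) ^ 2).card
    with hExcdef
  have hk : (Finset.univ.filter fun j => a j = true).card ≤ n :=
    (Finset.card_filter_le _ _).trans (by simp)
  have hNle := band_N_le κ C hκ hC n _ _ N E hk hb2 hb7 hN1 hN2 hE
  -- final real inequality
  have h2pos : (0 : ℝ) < 2 := by norm_num
  have hSR : (S.card : ℝ) ≤ (N : ℝ) + (Exc : ℝ) := by exact_mod_cast hD
  have hExcR : (Exc : ℝ) ≤ (1 / 2) * (2 : ℝ) ^ ((1 - δ) * (n : ℝ)) := by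
    have : (Exc : ℝ) ≤ ((2 ^ (n - n / 8 + 2) : ℕ) : ℝ) := by exact_mod_cast hExc
    exact this.trans (exc_numerics n hn128 δ hδ2)
  have hNR : (N : ℝ) ≤ (1 / 2) * (2 : ℝ) ^ ((1 - δ) * (n : ℝ)) := by
    refine hNle.trans ?_
    -- K ≤ ½ 2^{(7κ/64 − δ) n}
    have hκ7 : (0 : ℝ) < 7 * κ / 128 := by positivity
    have hn₁' : Real.logb 2 (2 * K) / (7 * κ / 128) ≤ (n : ℝ) :=
      hn₁.trans (by exact_mod_cast hnn₁)
    have hlog : Real.logb 2 (2 * K) ≤ (7 * κ / 128) * (n : ℝ) := by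
      rw [div_le_iff₀ hκ7] at hn₁'; linarith
    have h2K : 2 * K ≤ (2 : ℝ) ^ ((7 * κ / 128) * (n : ℝ)) :=
      (Real.logb_le_iff_le_rpow (by norm_num) (by positivity)).mp hlog
    have hexp : (7 * κ / 128) * (n : ℝ) ≤ (7 * κ / 64 - δ) * (n : ℝ) := by
      have : (0 : ℝ) ≤ n := Nat.cast_nonneg _
      nlinarith
    have h2K' : 2 * K ≤ (2 : ℝ) ^ ((7 * κ / 64 - δ) * (n : ℝ)) :=
      h2K.trans (Real.rpow_le_rpow_of_exponent_le (by norm_num) hexp)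
    have hsplit : (2 : ℝ) ^ ((1 - δ) * (n : ℝ)) =
        (2 : ℝ) ^ ((7 * κ / 64 - δ) * (n : ℝ)) * (2 : ℝ) ^ ((1 - 7 * κ / 64) * (n : ℝ)) := by
      rw [← Real.rpow_add h2pos]; ring_nf
    rw [hsplit]
    have hpos : (0 : ℝ) ≤ (2 : ℝ) ^ ((1 - 7 * κ / 64) * (n : ℝ)) := by positivity
    nlinarith
  linarith

end BandStub

end Summit.QuantumAdvantage.QuantumAdvantage.Theorems.SymplecticPurity
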